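import Literature.NumberTheory.Transcendental.MultipleZetaThreeOneProofs
import Mathlib.Algebra.Polynomial.Roots
import HarnessLib

/-!
# Multiple zeta values — `ζ({4}ⁿ) = 4ⁿ ζ({3,1}ⁿ) = 2^{2n+1} π⁴ⁿ/(4n+2)!`

Sibling proof file of `Literature.NumberTheory.Transcendental.MultipleZetaValues` (D-0014), in the
cone of the named fact `hoffmanSpan_eq_mzvSpace` (Brown 2012, Theorem 1.1). Borwein–Bradley–
Broadhurst–Lisoněk note ([BBBL1998], §6, after Theorem 1; [BBB1997]) that Zagier's `{3,1}`
evaluation is equivalent to `ζ({3,1}ⁿ) = 4⁻ⁿ ζ({4}ⁿ)`; we PROVE, for every `n`,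

* `sum_multipleZeta_twos_alternating_eq_fours` : the harmonic (stuffle) identity
  `∑_{q=0}^{2n} (-1)^q ζ({2}^{2n-q}) ζ({2}^q) = (-1)ⁿ ζ({4}ⁿ)` — the symmetric-function identity
  `E(t) E(-t) = ∏ₖ (1 - t²/k⁴)` for `E(t) = ∏ₖ (1 + t/k²) = ∑ₚ ζ({2}ᵖ) tᵖ`, proved for the
  truncations (`MZV.prod_range_one_add_div_pow`: `∏_{j<N} (1 + t/(j+1)ᵃ) = ∑ₙ Z_{N+1}({a}ⁿ) tⁿ`),
  where it is an identity of real polynomials in `t` (coefficients compared by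
  `Polynomial.funext`), and passed to the limit `N → ∞`;
* `multipleZeta_replicate_four_eq` : `ζ({4}ⁿ) = 4ⁿ ζ({3,1}ⁿ)` (with the shuffle identity
  `sum_multipleZeta_twos_alternating` of `MultipleZetaThreeOneProofs`: both equal
  `± ∑ (-1)^q ζ({2}^{2n-q}) ζ({2}^q)`);
* `multipleZeta_replicate_four` : **`ζ(4, 4, …, 4) = 2^{2n+1} π⁴ⁿ / (4n+2)!`**
  ([BBB1997]; `n = 1`: `ζ(4) = π⁴/90`).

`ζ({4}ⁿ) ∈ hoffmanSpan (4n)` was already known abstractly (`multipleZeta_replicate_even_mem_hoffmanSpan`,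
file `MultipleZetaNewtonProofs`); here is its closed form. No definitions, no named facts (D-0026).

## References

* J. M. Borwein, D. M. Bradley, D. J. Broadhurst, P. Lisoněk, *Combinatorial aspects of multiple
  zeta values*, Electron. J. Combin. **5** (1998), R38, §6 (arXiv:math/9812020). [BBBL1998]
* J. M. Borwein, D. M. Bradley, D. J. Broadhurst, *Evaluations of `k`-fold Euler/Zagier sums: a
  compendium of results for arbitrary `k`*, Electron. J. Combin. **4** (1997), R5 (the evaluation
  of `ζ({4}ⁿ)`). [BBB1997]
* M. E. Hoffman, *Multiple harmonic series*, Pacific J. Math. **152** (1992), 275–290, Theorem 2.2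
  (symmetric functions of the `1/nᵐ`). [Hoffman1992]
-/

noncomputable section

open scoped BigOperators Nat
open Filter Topology Real Polynomial

namespace Literature.NumberTheory.Transcendental

namespace MZV

/-! ### The finite product `∏_{j<N} (1 + t/(j+1)ᵃ)` for a general exponent `a` -/

/-- `{a}ᵏ⁺¹ = (a, {a}ᵏ)`-vanishing: `Z_N({a}ⁿ) = 0` for `1 ≤ n` and `N ≤ n`. [folklore] -/
theorem mzvTrunc_replicate_eq_zero (a : ℕ) {n N : ℕ} (hn : n ≠ 0) (h : N ≤ n) :
    mzvTrunc (List.replicate n a) N = 0 := by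
  obtain ⟨k, rfl⟩ := Nat.exists_eq_succ_of_ne_zero hn
  rw [List.replicate_succ]
  exact mzvTrunc_cons_eq_zero_of_le a _ (by simpa using h)

/-- One induction step: with `F_N(t) = ∑_{n ≤ N} Z_{N+1}({a}ⁿ) tⁿ`, `F_{N+1}(t) = F_N(t) (1 + t/(N+1)ᵃ)`
(stated for every `a`; `a = 0` is the binomial theorem). [folklore] -/
theorem sum_mzvTrunc_replicate_succ (a : ℕ) (t : ℝ) (N : ℕ) :
    ∑ n ∈ Finset.range (N + 1 + 1), mzvTrunc (List.replicate n a) (N + 1 + 1) * t ^ n =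
      (∑ n ∈ Finset.range (N + 1), mzvTrunc (List.replicate n a) (N + 1) * t ^ n) *
        (1 + t / ((N : ℝ) + 1) ^ a) := by
  have hc : ∀ n, mzvTrunc (List.replicate (n + 1) a) (N + 1 + 1) =
      mzvTrunc (List.replicate (n + 1) a) (N + 1) +
        (((N : ℝ) + 1) ^ a)⁻¹ * mzvTrunc (List.replicate n a) (N + 1) := by
    intro n
    have h := mzvTrunc_cons_succ a (List.replicate n a) (N := N + 1) (Nat.succ_pos N)
    rw [Nat.cast_succ] at h
    simpa only [List.replicate_succ] using h
  have hv : mzvTrunc (List.replicate (N + 1) a) (N + 1) = 0 :=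
    mzvTrunc_replicate_eq_zero a (Nat.succ_ne_zero N) le_rfl
  set A := ∑ n ∈ Finset.range N, mzvTrunc (List.replicate (n + 1) a) (N + 1) * t ^ (n + 1)
    with hA
  set B := ∑ n ∈ Finset.range (N + 1), mzvTrunc (List.replicate n a) (N + 1) * t ^ n with hB
  have hBA : B = A + 1 := by
    rw [hB, Finset.sum_range_succ']
    simp [hA]
  have hL : ∑ n ∈ Finset.range (N + 1 + 1), mzvTrunc (List.replicate n a) (N + 1 + 1) * t ^ n =
      A + (((N : ℝ) + 1) ^ a)⁻¹ * t * B + 1 := by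
    rw [Finset.sum_range_succ']
    simp only [hc, List.replicate_zero, mzvTrunc_nil, pow_zero, mul_one, add_mul,
      Finset.sum_add_distrib]
    rw [Finset.sum_range_succ, hv, zero_mul, add_zero, hB, Finset.mul_sum]
    congr 1
    congr 1
    refine Finset.sum_congr rfl fun n _ => ?_
    ring
  rw [hL, hBA]
  have hN : ((N : ℝ) + 1) ^ a ≠ 0 := by positivity
  field_simp
  ring

/-- **`∏_{j<N} (1 + t/(j+1)ᵃ) = ∑_{n ≤ N} Z_{N+1}({a}ⁿ) tⁿ`**: the elementary symmetric
functions of the `1/mᵃ`, `m ≤ N`, are the truncated sums `Z_{N+1}(a, …, a)` (Hoffman 1992,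
Theorem 2.2 / Hoffman 1997, Example 1). [cite: Hoffman1992, Theorem 2.2] -/
theorem prod_range_one_add_div_pow (a : ℕ) (t : ℝ) : ∀ N : ℕ,
    ∏ j ∈ Finset.range N, (1 + t / ((j : ℝ) + 1) ^ a) =
      ∑ n ∈ Finset.range (N + 1), mzvTrunc (List.replicate n a) (N + 1) * t ^ n
  | 0 => by simp
  | N + 1 => by
      rw [Finset.prod_range_succ, prod_range_one_add_div_pow a t N]
      exact (sum_mzvTrunc_replicate_succ a t N).symm

/-- `{a}ⁿ` is admissible for `a ≥ 2`. [folklore] -/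
theorem isAdmissible_replicate' {a : ℕ} (ha : 2 ≤ a) (n : ℕ) : IsAdmissible (List.replicate n a) :=
  ⟨fun i hi => by rw [List.eq_of_mem_replicate hi]; omega,
    fun h => by cases n with
      | zero => exact absurd rfl h
      | succ n => simpa using ha⟩

end MZV

open MZV

/-! ### The polynomial identity `E_N(t) E_N(-t) = F_N(-t²)` and its coefficients -/

/-- The coefficient of `tᵖ` in `∑_{n ≤ N} cₙ tⁿ`. [folklore] -/
theorem coeff_sum_C_mul_X_pow (c : ℕ → ℝ) (N p : ℕ) :
    (∑ n ∈ Finset.range (N + 1), C (c n) * X ^ n : ℝ[X]).coeff p = if p ≤ N then c p else 0 := by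
  rw [finsetSum_coeff]
  simp only [coeff_C_mul_X_pow]
  rw [Finset.sum_ite_eq (Finset.range (N + 1)) p c]
  simp

/-- `(-1)^{2n-q} = (-1)^q` for `q ≤ 2n`. [folklore] -/
theorem neg_one_pow_two_mul_sub {n q : ℕ} (h : q ≤ 2 * n) : (-1 : ℝ) ^ (2 * n - q) = (-1) ^ q := by
  rcases Nat.even_or_odd q with hq | hq
  · rw [hq.neg_one_pow, (show Even (2 * n - q) by
      obtain ⟨k, hk⟩ := hq; exact ⟨n - k, by omega⟩).neg_one_pow]
  · rw [hq.neg_one_pow, (show Odd (2 * n - q) by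
      obtain ⟨k, hk⟩ := hq; exact ⟨n - k - 1, by omega⟩).neg_one_pow]

/-- The truncated identity: for `2n ≤ N`,
`∑_{q=0}^{2n} (-1)^q Z_{N+1}({2}^{2n-q}) Z_{N+1}({2}^q) = (-1)ⁿ Z_{N+1}({4}ⁿ)` — the coefficient of
`t^{2n}` in `∏_{j<N} (1 + t/(j+1)²)(1 - t/(j+1)²) = ∏_{j<N} (1 - t²/(j+1)⁴)`.
[cite: Hoffman1992, Theorem 2.2] -/
theorem sum_mzvTrunc_twos_alternating_eq_fours {n N : ℕ} (hN : 2 * n ≤ N) :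
    ∑ q ∈ Finset.range (2 * n + 1), (-1 : ℝ) ^ q *
        (mzvTrunc (List.replicate (2 * n - q) 2) (N + 1) * mzvTrunc (List.replicate q 2) (N + 1)) =
      (-1) ^ n * mzvTrunc (List.replicate n 4) (N + 1) := by
  -- the three polynomials
  set E : ℝ[X] := ∑ m ∈ Finset.range (N + 1), C (mzvTrunc (List.replicate m 2) (N + 1)) * X ^ m with hE
  set Em : ℝ[X] := ∑ m ∈ Finset.range (N + 1),
    C ((-1) ^ m * mzvTrunc (List.replicate m 2) (N + 1)) * X ^ m with hEm
  set F : ℝ[X] := ∑ m ∈ Finset.range (N + 1),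
    C ((-1) ^ m * mzvTrunc (List.replicate m 4) (N + 1)) * X ^ (2 * m) with hF
  -- they satisfy `E * Em = F` as functions, hence as polynomials
  have hEF : E * Em = F := by
    apply Polynomial.funext
    intro t
    have h2 := prod_range_one_add_div_pow 2 t N
    have h2m := prod_range_one_add_div_pow 2 (-t) N
    have h4 := prod_range_one_add_div_pow 4 (-t ^ 2) N
    have eE : E.eval t = ∏ j ∈ Finset.range N, (1 + t / ((j : ℝ) + 1) ^ 2) := by
      rw [h2, hE, eval_finsetSum]
      simp only [eval_mul, eval_C, eval_pow, eval_X]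
    have eEm : Em.eval t = ∏ j ∈ Finset.range N, (1 + -t / ((j : ℝ) + 1) ^ 2) := by
      rw [h2m, hEm, eval_finsetSum]
      simp only [eval_mul, eval_C, eval_pow, eval_X]
      refine Finset.sum_congr rfl fun m _ => ?_
      rw [neg_pow]
      ring
    have eF : F.eval t = ∏ j ∈ Finset.range N, (1 + -t ^ 2 / ((j : ℝ) + 1) ^ 4) := by
      rw [h4, hF, eval_finsetSum]
      simp only [eval_mul, eval_C, eval_pow, eval_X]
      refine Finset.sum_congr rfl fun m _ => ?_
      rw [neg_pow, pow_mul]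
      ring
    rw [eval_mul, eE, eEm, eF, ← Finset.prod_mul_distrib]
    refine Finset.prod_congr rfl fun j _ => ?_
    have hj : ((j : ℝ) + 1) ≠ 0 := by positivity
    field_simp
    ring
  -- compare the coefficients of `t^{2n}`
  have hcoef := congrArg (fun P : ℝ[X] => P.coeff (2 * n)) hEF
  rw [coeff_mul, Finset.Nat.sum_antidiagonal_eq_sum_range_succ
    (fun i j => E.coeff i * Em.coeff j) (2 * n)] at hcoef
  have hcE : ∀ p, E.coeff p = if p ≤ N then mzvTrunc (List.replicate p 2) (N + 1) else 0 :=
    coeff_sum_C_mul_X_pow _ N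
  have hcEm : ∀ p, Em.coeff p = if p ≤ N then (-1) ^ p * mzvTrunc (List.replicate p 2) (N + 1) else 0 :=
    coeff_sum_C_mul_X_pow _ N
  have hcF : F.coeff (2 * n) = (-1) ^ n * mzvTrunc (List.replicate n 4) (N + 1) := by
    rw [hF, finsetSum_coeff]
    simp only [coeff_C_mul_X_pow]
    rw [Finset.sum_eq_single n]
    · simp
    · intro m _ hmn
      rw [if_neg (by omega)]
    · intro hn'
      rw [Finset.mem_range] at hn'
      omega
  rw [hcF] at hcoef
  rw [← hcoef]
  refine Finset.sum_congr rfl fun q hq => ?_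
  rw [Finset.mem_range] at hq
  rw [hcE, hcEm, if_pos (by omega), if_pos (by omega), neg_one_pow_two_mul_sub (by omega)]
  ring

/-! ### The limit `N → ∞` and the evaluations -/

/-- **The harmonic-product identity `∑_{q=0}^{2n} (-1)^q ζ({2}^{2n-q}) ζ({2}^q) = (-1)ⁿ ζ({4}ⁿ)`**
(`E(t)E(-t) = ∏ (1 - t²/k⁴)` for the generating function `E(t) = ∑ ζ({2}ᵖ) tᵖ = ∏ (1 + t/k²)`;
Hoffman 1992, Theorem 2.2), from the truncated identity by letting `N → ∞`.
[cite: Hoffman1992, Theorem 2.2] -/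
theorem sum_multipleZeta_twos_alternating_eq_fours (n : ℕ) :
    ∑ q ∈ Finset.range (2 * n + 1), (-1 : ℝ) ^ q *
        (multipleZeta (List.replicate (2 * n - q) 2) * multipleZeta (List.replicate q 2)) =
      (-1) ^ n * multipleZeta (List.replicate n 4) := by
  have hZ : ∀ (s : List ℕ), IsAdmissible s →
      Tendsto (fun N : ℕ => mzvTrunc s (N + 1)) atTop (𝓝 (multipleZeta s)) := fun s hs =>
    (tendsto_mzvTrunc hs).comp (tendsto_add_atTop_nat 1)
  have hL : Tendsto (fun N : ℕ => ∑ q ∈ Finset.range (2 * n + 1), (-1 : ℝ) ^ q *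
      (mzvTrunc (List.replicate (2 * n - q) 2) (N + 1) * mzvTrunc (List.replicate q 2) (N + 1)))
      atTop (𝓝 (∑ q ∈ Finset.range (2 * n + 1), (-1 : ℝ) ^ q *
        (multipleZeta (List.replicate (2 * n - q) 2) * multipleZeta (List.replicate q 2)))) :=
    tendsto_finsetSum _ fun q _ =>
      ((hZ _ (isAdmissible_replicate_two _)).mul (hZ _ (isAdmissible_replicate_two _))).const_mul _
  have hR : Tendsto (fun N : ℕ => (-1 : ℝ) ^ n * mzvTrunc (List.replicate n 4) (N + 1)) atTop
      (𝓝 ((-1) ^ n * multipleZeta (List.replicate n 4))) :=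
    (hZ _ (isAdmissible_replicate' (by norm_num) n)).const_mul _
  have heq : (fun N : ℕ => ∑ q ∈ Finset.range (2 * n + 1), (-1 : ℝ) ^ q *
      (mzvTrunc (List.replicate (2 * n - q) 2) (N + 1) * mzvTrunc (List.replicate q 2) (N + 1))) =ᶠ[atTop]
      fun N : ℕ => (-1 : ℝ) ^ n * mzvTrunc (List.replicate n 4) (N + 1) :=
    Filter.eventually_atTop.2 ⟨2 * n, fun N hN => sum_mzvTrunc_twos_alternating_eq_fours hN⟩
  exact tendsto_nhds_unique (hL.congr' heq) hR

/-- **`ζ({4}ⁿ) = 4ⁿ ζ({3,1}ⁿ)`** ([BBBL1998], §6: the stuffle identity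
`sum_multipleZeta_twos_alternating_eq_fours` and the shuffle identity
`sum_multipleZeta_twos_alternating` have the same left-hand side). [cite: BBBL1998, §6] -/
theorem multipleZeta_replicate_four_eq (n : ℕ) :
    multipleZeta (List.replicate n 4) = 4 ^ n * multipleZeta (List.replicate n [3, 1]).flatten := by
  have h1 := sum_multipleZeta_twos_alternating n
  have h2 := sum_multipleZeta_twos_alternating_eq_fours n
  have h4 : (-4 : ℝ) ^ n = (-1) ^ n * 4 ^ n := by
    rw [← mul_pow]; norm_num
  have h3 : (-1 : ℝ) ^ n * multipleZeta (List.replicate n 4) =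
      (-1 : ℝ) ^ n * (4 ^ n * multipleZeta (List.replicate n [3, 1]).flatten) := by
    rw [← h2, h1, h4]
    ring
  exact mul_left_cancel₀ (pow_ne_zero _ (by norm_num)) h3

/-- **`ζ(4, 4, …, 4) = ζ({4}ⁿ) = 2^{2n+1} π⁴ⁿ / (4n+2)!`** for every `n` ([BBB1997]; [BBBL1998], §6;
`n = 1`: `ζ(4) = π⁴/90`, `n = 2`: `ζ(4,4) = π⁸/113400`). [cite: BBBL1998, §6] -/
theorem multipleZeta_replicate_four (n : ℕ) :
    multipleZeta (List.replicate n 4) = 2 ^ (2 * n + 1) * π ^ (4 * n) / (Nat.factorial (4 * n + 2) : ℝ) := by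
  rw [multipleZeta_replicate_four_eq, multipleZeta_threeOne, show (4 : ℝ) ^ n = 2 ^ (2 * n) by
    rw [pow_mul]; norm_num]
  ring

/-- `ζ(4,4) = π⁸/113400`. [cite: BBBL1998, §6] -/
example : multipleZeta [4, 4] = π ^ 8 / 113400 := by
  rw [show [4, 4] = List.replicate 2 4 from rfl, multipleZeta_replicate_four]
  norm_num [Nat.factorial]
  ring

end Literature.NumberTheory.Transcendental
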